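import Summits.QuantumFields.YangMills.Theorems.BalabanUVNodesN19JointLawBernstein
import Literature.Analysis.Quadrature.JacksonBoundedDerivProofs

/-!
# YM-DAG node N19 (= NE7 proper) — THE DISCRETE TENSOR JACKSON QUASI-INTERPOLANT, I: kernel, discrete orthogonality, exact node sums, first moment

Cell `pub-ymgap`, HUMAN RULING D-0062 (Track A), R141 (C) wider-strategy seat `pub-ymgap-dag-n19-e` (strategy s3 = ALTERNATIVE CURRENCY), generation
g20, module 1 (lineage module 59).  Route `Summits/QuantumFields/YangMills/Theses/BalabanUVNodes.lean` rev 25, cluster item K3⁷ «SpineGivenEndpointR13SepCoPH»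
(stmt-QuantumFields-20544, dag-lead WORDS-143); filed `--supports` that item `--as helper` (it proves no registered stub).  COUNT-NEUTRAL: [folklore] real
analysis over Mathlib (`Complex.exp_eq_one_iff`, `geom_sum_eq`, `Real.mul_le_sin`, `Real.abs_cos_sub_cos_le`, `round`, `Fintype.prod_sum`) + the TREE's
Jackson-kernel lemmas `Literature.Analysis.Quadrature.Jackson.fejer_identity ∕ fejer_sq_eq ∕ sum_sum_sub_abs` BY IMPORT (its private `card_filter_pairs` and
Jordan inequality are re-derived here, credited); Mathlib-generic, no scheme object; NOT a discharge claim.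

THE POINT.  The lineage's joint-law rate (p570436 `…N19JointLawRate`) runs on the tensor BERNSTEIN operator and pays `n^{−1∕2}` per coordinate; its
docstring and two referee reads (ref-K #161, ref-I #312) record «NOT claimed sharp — multivariate Jackson would give `n^{−1}`».  A multivariate Jackson
CONVOLUTION theorem is not needed: the DISCRETE tensor Jackson quasi-interpolant does the same job with finite sums only.  With the tree's Fejér sum
`F_m(u) = Σ_{j₁,j₂<m} cos((j₁−j₂)u)` (so `F_m² =` Jackson's kernel, a cosine polynomial of degree `2m−2` with constant term `c_m = m(2m²+1)∕3`), the
`N = 2m` (any `N ≥ 2m`) equispaced nodes `θ_a = 2πa∕N` and the WEIGHTS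
  `W_a(t) = (F_m(t − θ_a)² + F_m(t + θ_a)²) ∕ (2N·c_m)`   (`a < N`; displayed, never named),
* §1 DISCRETE ORTHOGONALITY: `Σ_{a<N} cos(s + k·θ_a) = 0` for `N ∤ k` (a geometric sum of the root of unity `e^{2πik∕N} ≠ 1`), `= N cos s` for `k = 0`;
* §2 hence EXACT node sums (every frequency of `F_m²` and of `(2 − 2cos)·F_m² = 2(1 − cos(m·))F_m` — Fejér's identity — lies in `(−N, N)`):
  `Σ_a F_m(t − θ_a)² = N·c_m` (the count `#{j₁−j₂+j₃−j₄ = 0} = c_m`, `sum_sum_sub_abs`) and `Σ_a (2 − 2cos(t − θ_a))·F_m(t − θ_a)² = 2Nm`;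
* §3 FIRST MOMENT `Σ_a F_m(t − θ_a)²·|cos t − cos θ_a| ≤ πN c_m∕m`: reduce `t − θ_a` mod `2π` to `|v| ≤ π`, `|cos t − cos θ_a| ≤ |v|` (cos is `1`-Lipschitz),
  `2|v| ≤ (m∕π)v² + π∕m`, Jordan `v² ≤ (π²∕4)(2 − 2cos v)`, §2, and `m³ ≤ 2c_m`;
* (sibling `…N19DiscreteJacksonTensor`, module 60) so `W_a ≥ 0`, `Σ_a W_a(t) = 1`, `Σ_a W_a(t)|cos t − cos θ_a| ≤ π∕m`, and — the other coordinates
  summing out exactly as in module 55 — for `g` with `|g u − g v| ≤ K Σ_i|u_i − v_i|` on `[−1,1]^ι` and every `t : ι → ℝ`,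
  `|Σ_{a : ι → [N]} g((cos θ_{a_i})_i)·∏_i W_{a_i}(t_i) − g((cos t_i)_i)| ≤ πK|ι|∕m`  — RATE `m⁻¹`.
The pricing sibling (module 61) shows `∏_i W_{a_i}(arccos x_i)` is a product of univariate polynomials of degree `≤ 2m−2` in the `x_i` (Chebyshev
`T_k(cos t) = cos(kt)`) with total `ℓ¹` coefficient mass `≤ (m·9^m)^{|ι|}`, prices it at the mixed moments (module 55 `abs_integral_prod_eval_sub_le`), and
assembles `|∫f dP − ∫f dQ| ≤ 2πK|ι|∕m + G·(m·9^m)^{|ι|}·r` — the `n^{−1}` road to the continuum joint laws.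

HONEST FRAMING (binding).  [folklore] (D. Jackson 1911; discrete de la Vallée-Poussin ∕ Jackson quasi-interpolants); Mathlib-generic; NO consumer in the
DAG today (it sharpens the lineage's own joint-law rate); nothing of Bałaban's instantiated; NE7 NOT PRINTED, NOT proved; N19 NOT discharged; count-neutral.
One finite `T⁴` programme at fixed `ε`; nothing continuum ∕ `ℝ⁴` ∕ OS ∕ mass-gap ∕ Clay.  0 `def` ∕ 0 `sorry`.
-/

noncomputable section

open Real Finset

namespace Summit.QuantumFields.YangMills.Theorems.BalabanUVNodesN19DiscreteJackson

open Literature.Analysis.Quadrature.Jackson (fejer_identity fejer_sq_eq sum_sum_sub_abs)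

/-! ## §1 Discrete orthogonality of the cosines at the equispaced nodes `θ_a = 2πa∕N` [folklore] -/

/-- **DISCRETE ORTHOGONALITY.**  If `N ∤ k` then `Σ_{a<N} cos(s + k·2πa∕N) = 0`: the real part of `e^{is}·Σ_a ζ^a`, `ζ = e^{2πik∕N} ≠ 1`, `ζ^N = 1`
(`geom_sum_eq`). [folklore] -/
theorem sum_cos_add_int_mul_node {N : ℕ} (hN : N ≠ 0) {k : ℤ} (hk : ¬ ((N : ℤ) ∣ k)) (s : ℝ) :
    ∑ a ∈ range N, Real.cos (s + k * (2 * π * a / N)) = 0 := by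
  have hNr : (N : ℝ) ≠ 0 := Nat.cast_ne_zero.2 hN
  set ζ : ℂ := Complex.exp ((((k : ℝ) * (2 * π / N) : ℝ) : ℂ) * Complex.I) with hζ
  have hζN : ζ ^ N = 1 := by
    rw [hζ, ← Complex.exp_nat_mul]
    have e : (N : ℂ) * ((((k : ℝ) * (2 * π / N) : ℝ) : ℂ) * Complex.I) = (k : ℂ) * (2 * π * Complex.I) := by
      push_cast
      field_simp
    rw [e]
    exact Complex.exp_int_mul_two_pi_mul_I k
  have hζ1 : ζ ≠ 1 := by
    intro h
    rw [hζ, Complex.exp_eq_one_iff] at h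
    obtain ⟨n, hn⟩ := h
    have him := congrArg Complex.im hn
    simp only [Complex.mul_im, Complex.ofReal_re, Complex.ofReal_im, Complex.I_re, Complex.I_im, mul_zero, mul_one,
      zero_add, Complex.mul_re, Complex.intCast_re, Complex.intCast_im, Complex.re_ofNat, Complex.im_ofNat,
      Complex.ofReal_mul, Complex.ofReal_ofNat, zero_mul, sub_zero, Complex.ofReal_div, Complex.ofReal_natCast,
      Complex.div_natCast_im, Complex.div_natCast_re] at him
    -- `him : k * (2 * π / N) = n * (2 * π)` (up to normal form)
    have hkn : (k : ℝ) = n * N := by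
      have hπ : (π : ℝ) ≠ 0 := Real.pi_ne_zero
      field_simp at him
      nlinarith [him, Real.pi_pos]
    exact hk ⟨n, by exact_mod_cast (by rw [hkn]; ring : (k : ℝ) = N * n)⟩
  have hterm : ∀ a : ℕ, Real.cos (s + k * (2 * π * a / N)) = (Complex.exp ((s : ℂ) * Complex.I) * ζ ^ a).re := by
    intro a
    rw [hζ, ← Complex.exp_nat_mul, ← Complex.exp_add]
    have e : (s : ℂ) * Complex.I + (a : ℂ) * ((((k : ℝ) * (2 * π / N) : ℝ) : ℂ) * Complex.I) =
        (((s + k * (2 * π * a / N) : ℝ)) : ℂ) * Complex.I := by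
      push_cast
      ring
    rw [e, Complex.exp_ofReal_mul_I_re]
  simp_rw [hterm]
  rw [← Complex.re_sum, ← Finset.mul_sum, geom_sum_eq hζ1, hζN, sub_self, zero_div, mul_zero, Complex.zero_re]

/-- For `|k| < N`: `Σ_{a<N} cos(s + k·2πa∕N) = N cos s` if `k = 0`, else `0`. [folklore] -/
theorem sum_cos_int_mul_node_eq {N : ℕ} (hN : N ≠ 0) {k : ℤ} (hk : k.natAbs < N) (s : ℝ) :
    ∑ a ∈ range N, Real.cos (s + k * (2 * π * a / N)) = if k = 0 then (N : ℝ) * Real.cos s else 0 := by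
  split_ifs with h0
  · simp [h0]
  · refine sum_cos_add_int_mul_node hN (fun hd => h0 ?_) s
    exact Int.eq_zero_of_dvd_of_natAbs_lt_natAbs hd (by simpa using hk)

/-! ## §2 Exact node sums of the Jackson kernel `F_m²` [folklore] -/

/-- For `j₁, j₂ < m` there are exactly `m − |j₁ − j₂|` pairs `(j₃, j₄) ∈ [0, m)²` with `j₁ − j₂ + j₃ − j₄ = 0` (re-derivation of the tree's private
`Literature.Analysis.Quadrature.Jackson.card_filter_pairs`, same proof). [folklore] -/
theorem card_filter_jacksonPairs (m j₁ j₂ : ℕ) (h₁ : j₁ < m) (h₂ : j₂ < m) :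
    ((range m ×ˢ range m).filter
        (fun q : ℕ × ℕ => (j₁ : ℤ) - j₂ + q.1 - q.2 = 0)).card = m - ((j₁ : ℤ) - j₂).natAbs := by
  rcases le_or_gt j₂ j₁ with hle | hlt
  · have he : ((j₁ : ℤ) - j₂).natAbs = j₁ - j₂ := by omega
    rw [he]
    have hset : (range m ×ˢ range m).filter (fun q : ℕ × ℕ => (j₁ : ℤ) - j₂ + q.1 - q.2 = 0)
        = (range (m - (j₁ - j₂))).image (fun j => (j, j + (j₁ - j₂))) := by
      ext ⟨x, y⟩
      simp only [Finset.mem_filter, Finset.mem_product, Finset.mem_range, Finset.mem_image, Prod.mk.injEq]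
      constructor
      · rintro ⟨⟨hx, hy⟩, hxy⟩
        exact ⟨x, by omega, rfl, by omega⟩
      · rintro ⟨j, hj, rfl, rfl⟩
        omega
    rw [hset, Finset.card_image_of_injective _ (fun a b hab => by simpa using congrArg Prod.fst hab),
      Finset.card_range]
  · have he : ((j₁ : ℤ) - j₂).natAbs = j₂ - j₁ := by omega
    rw [he]
    have hset : (range m ×ˢ range m).filter (fun q : ℕ × ℕ => (j₁ : ℤ) - j₂ + q.1 - q.2 = 0)
        = (range (m - (j₂ - j₁))).image (fun j => (j + (j₂ - j₁), j)) := by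
      ext ⟨x, y⟩
      simp only [Finset.mem_filter, Finset.mem_product, Finset.mem_range, Finset.mem_image, Prod.mk.injEq]
      constructor
      · rintro ⟨⟨hx, hy⟩, hxy⟩
        exact ⟨y, by omega, by omega, rfl⟩
      · rintro ⟨j, hj, rfl, rfl⟩
        omega
    rw [hset, Finset.card_image_of_injective _ (fun a b hab => by simpa using congrArg Prod.snd hab),
      Finset.card_range]

/-- **THE CONSTANT TERM OF THE JACKSON KERNEL**: `#{(j₁,j₂,j₃,j₄) ∈ [0,m)⁴ : j₁ − j₂ + j₃ − j₄ = 0} = m(2m²+1)∕3 =: c_m` (the tree's `sum_sum_sub_abs`).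
[cite: ButzerNessel1971, Problem 1.3.9 — the normalising constant; folklore] -/
theorem jacksonCount_eq (m : ℕ) :
    ∑ x ∈ (range m ×ˢ range m) ×ˢ (range m ×ˢ range m),
        (if ((x.1.1 : ℤ) - x.1.2 + x.2.1 - x.2.2 : ℤ) = 0 then (1 : ℝ) else 0) = (m : ℝ) * (2 * m ^ 2 + 1) / 3 := by
  rw [← sum_sum_sub_abs m, Finset.sum_product, Finset.sum_product]
  refine Finset.sum_congr rfl fun j₁ hj₁ => Finset.sum_congr rfl fun j₂ hj₂ => ?_
  have hj₁' := Finset.mem_range.1 hj₁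
  have hj₂' := Finset.mem_range.1 hj₂
  rw [Finset.sum_boole, card_filter_jacksonPairs m j₁ j₂ hj₁' hj₂']
  have hle : ((j₁ : ℤ) - j₂).natAbs ≤ m := by omega
  have e : ((((j₁ : ℤ) - j₂).natAbs : ℕ) : ℝ) = |(j₁ : ℝ) - j₂| := by
    rw [← Int.cast_natCast, Int.natCast_natAbs, Int.cast_abs]
    push_cast
    ring_nf
  rw [Nat.cast_sub hle, e]

/-- Frequencies of the Jackson kernel: `|j₁ − j₂ + j₃ − j₄| < 2m ≤ N`. [bookkeeping] -/
theorem natAbs_jacksonFreq_lt {m N : ℕ} (hN : 2 * m ≤ N) {x : (ℕ × ℕ) × (ℕ × ℕ)}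
    (hx : x ∈ (range m ×ˢ range m) ×ˢ (range m ×ˢ range m)) :
    ((x.1.1 : ℤ) - x.1.2 + x.2.1 - x.2.2).natAbs < N := by
  simp only [Finset.mem_product, Finset.mem_range] at hx
  omega

/-- **MASS**: `Σ_{a<N} F_m(t − 2πa∕N)² = N·c_m` for `2m ≤ N`, `m ≥ 1` (expand `F_m²` by `fejer_sq_eq`, §1 termwise, count by `jacksonCount_eq`). [folklore] -/
theorem sum_fejerSq_node_eq {m N : ℕ} (hm : 0 < m) (hN : 2 * m ≤ N) (t : ℝ) :
    ∑ a ∈ range N, (∑ j₁ ∈ range m, ∑ j₂ ∈ range m, Real.cos (((j₁ : ℝ) - j₂) * (t - 2 * π * a / N))) ^ 2 =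
      (N : ℝ) * (m * (2 * m ^ 2 + 1) / 3) := by
  have hN0 : N ≠ 0 := by omega
  simp_rw [fejer_sq_eq]
  rw [Finset.sum_comm, ← jacksonCount_eq, Finset.mul_sum]
  refine Finset.sum_congr rfl fun x hx => ?_
  have hfreq := natAbs_jacksonFreq_lt hN hx
  have hterm : ∀ a : ℕ, Real.cos ((((x.1.1 : ℤ) - x.1.2 + x.2.1 - x.2.2 : ℤ) : ℝ) * (t - 2 * π * a / N)) =
      Real.cos ((((x.1.1 : ℤ) - x.1.2 + x.2.1 - x.2.2 : ℤ) : ℝ) * t +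
        ((-(((x.1.1 : ℤ) - x.1.2 + x.2.1 - x.2.2 : ℤ)) : ℤ) : ℝ) * (2 * π * a / N)) := fun a => by
    push_cast; ring_nf
  simp_rw [hterm]
  rw [sum_cos_int_mul_node_eq hN0 (by rwa [Int.natAbs_neg]) _]
  simp only [neg_eq_zero]
  split_ifs with h0
  · rw [h0]; simp
  · simp

/-- **SECOND MOMENT**: `Σ_{a<N} (2 − 2cos(t − 2πa∕N))·F_m(t − 2πa∕N)² = 2Nm` for `2m ≤ N`, `m ≥ 1`: Fejér's identity `(1 − cos u)F_m(u) = 1 − cos(mu)`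
leaves `2F_m − 2cos(m·)F_m`, whose node sums are `2Nm` and `0` by §1 (frequencies `j₁ − j₂` and `m ± (j₁ − j₂)` lie in `(−N, N)`, the latter `≠ 0`). [folklore] -/
theorem sum_two_sub_two_cos_mul_fejerSq_node_eq {m N : ℕ} (hm : 0 < m) (hN : 2 * m ≤ N) (t : ℝ) :
    ∑ a ∈ range N, (2 - 2 * Real.cos (t - 2 * π * a / N)) *
        (∑ j₁ ∈ range m, ∑ j₂ ∈ range m, Real.cos (((j₁ : ℝ) - j₂) * (t - 2 * π * a / N))) ^ 2 = (2 * N * m : ℝ) := by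
  have hN0 : N ≠ 0 := by omega
  -- Fejér: `(2 − 2cos u)·F² = 2F − 2cos(mu)F`
  have hF : ∀ u : ℝ, (2 - 2 * Real.cos u) * (∑ j₁ ∈ range m, ∑ j₂ ∈ range m, Real.cos (((j₁ : ℝ) - j₂) * u)) ^ 2 =
      2 * (∑ j₁ ∈ range m, ∑ j₂ ∈ range m, Real.cos (((j₁ : ℝ) - j₂) * u)) -
        2 * (∑ j₁ ∈ range m, ∑ j₂ ∈ range m, Real.cos ((m : ℝ) * u) * Real.cos (((j₁ : ℝ) - j₂) * u)) := by
    intro u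
    have h := fejer_identity m u
    have e : Real.cos ((m : ℝ) * u) * ∑ j₁ ∈ range m, ∑ j₂ ∈ range m, Real.cos (((j₁ : ℝ) - j₂) * u) =
        ∑ j₁ ∈ range m, ∑ j₂ ∈ range m, Real.cos ((m : ℝ) * u) * Real.cos (((j₁ : ℝ) - j₂) * u) := by
      rw [Finset.mul_sum]
      exact Finset.sum_congr rfl fun j₁ _ => Finset.mul_sum _ _ _
    calc (2 - 2 * Real.cos u) * (∑ j₁ ∈ range m, ∑ j₂ ∈ range m, Real.cos (((j₁ : ℝ) - j₂) * u)) ^ 2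
        = 2 * ((1 - Real.cos u) * ∑ j₁ ∈ range m, ∑ j₂ ∈ range m, Real.cos (((j₁ : ℝ) - j₂) * u)) *
            ∑ j₁ ∈ range m, ∑ j₂ ∈ range m, Real.cos (((j₁ : ℝ) - j₂) * u) := by ring
      _ = _ := by rw [h, ← e]; ring
  simp_rw [hF]
  rw [Finset.sum_sub_distrib, ← Finset.mul_sum, ← Finset.mul_sum]
  -- the plain Fejér node sum `= N m`
  have h1 : ∑ a ∈ range N, ∑ j₁ ∈ range m, ∑ j₂ ∈ range m, Real.cos (((j₁ : ℝ) - j₂) * (t - 2 * π * a / N)) = (N * m : ℝ) := by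
    rw [Finset.sum_comm]
    have hj : ∀ j₁ ∈ range m, ∑ a ∈ range N, ∑ j₂ ∈ range m, Real.cos (((j₁ : ℝ) - j₂) * (t - 2 * π * a / N)) = (N : ℝ) := by
      intro j₁ hj₁
      rw [Finset.sum_comm]
      have hj₂ : ∀ j₂ ∈ range m, ∑ a ∈ range N, Real.cos (((j₁ : ℝ) - j₂) * (t - 2 * π * a / N)) =
          if j₁ = j₂ then (N : ℝ) else 0 := by
        intro j₂ hj₂
        have hlt : (((j₁ : ℤ) - j₂ : ℤ)).natAbs < N := by
          have := Finset.mem_range.1 hj₁; have := Finset.mem_range.1 hj₂; omega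
        have e : ∀ a : ℕ, Real.cos (((j₁ : ℝ) - j₂) * (t - 2 * π * a / N)) =
            Real.cos ((((j₁ : ℤ) - j₂ : ℤ) : ℝ) * t + ((-((j₁ : ℤ) - j₂) : ℤ) : ℝ) * (2 * π * a / N)) := fun a => by
          push_cast; ring_nf
        simp_rw [e]
        rw [sum_cos_int_mul_node_eq hN0 (by rw [Int.natAbs_neg]; exact hlt)]
        by_cases h : j₁ = j₂
        · subst h; simp
        · have hne : (-((j₁ : ℤ) - j₂) : ℤ) ≠ 0 := by omega
          rw [if_neg hne, if_neg h]
      rw [Finset.sum_congr rfl hj₂, Finset.sum_ite_eq, if_pos hj₁]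
    rw [Finset.sum_congr rfl hj, Finset.sum_const, Finset.card_range, nsmul_eq_mul, mul_comm]
  -- the `cos(m·)F` node sum vanishes
  have h2 : ∑ a ∈ range N, ∑ j₁ ∈ range m, ∑ j₂ ∈ range m,
      Real.cos ((m : ℝ) * (t - 2 * π * a / N)) * Real.cos (((j₁ : ℝ) - j₂) * (t - 2 * π * a / N)) = 0 := by
    rw [Finset.sum_comm]
    refine Finset.sum_eq_zero fun j₁ hj₁ => ?_
    rw [Finset.sum_comm]
    refine Finset.sum_eq_zero fun j₂ hj₂ => ?_
    have hj₁' := Finset.mem_range.1 hj₁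
    have hj₂' := Finset.mem_range.1 hj₂
    -- `cos A cos B = (cos(A+B) + cos(A−B))∕2` (also `Literature.Barriers.CriticalPhenomena.cos_mul_cos_eq`; two lines, not worth the import)
    have hcc : ∀ A B : ℝ, Real.cos A * Real.cos B = (Real.cos (A + B) + Real.cos (A - B)) / 2 := fun A B => by
      rw [Real.cos_add, Real.cos_sub]; ring
    simp_rw [hcc]
    rw [← Finset.sum_div, Finset.sum_add_distrib]
    have hp : ∑ a ∈ range N, Real.cos ((m : ℝ) * (t - 2 * π * a / N) + ((j₁ : ℝ) - j₂) * (t - 2 * π * a / N)) = 0 := by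
      have e : ∀ a : ℕ, Real.cos ((m : ℝ) * (t - 2 * π * a / N) + ((j₁ : ℝ) - j₂) * (t - 2 * π * a / N)) =
          Real.cos ((((m : ℤ) + j₁ - j₂ : ℤ) : ℝ) * t + ((-((m : ℤ) + j₁ - j₂) : ℤ) : ℝ) * (2 * π * a / N)) := fun a => by
        push_cast; ring_nf
      simp_rw [e]
      refine sum_cos_add_int_mul_node hN0 (fun hd => ?_) _
      have := Int.eq_zero_of_dvd_of_natAbs_lt_natAbs hd (by simp only [Int.natAbs_neg, Int.natAbs_natCast]; omega)
      omega
    have hq : ∑ a ∈ range N, Real.cos ((m : ℝ) * (t - 2 * π * a / N) - ((j₁ : ℝ) - j₂) * (t - 2 * π * a / N)) = 0 := by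
      have e : ∀ a : ℕ, Real.cos ((m : ℝ) * (t - 2 * π * a / N) - ((j₁ : ℝ) - j₂) * (t - 2 * π * a / N)) =
          Real.cos ((((m : ℤ) - j₁ + j₂ : ℤ) : ℝ) * t + ((-((m : ℤ) - j₁ + j₂) : ℤ) : ℝ) * (2 * π * a / N)) := fun a => by
        push_cast; ring_nf
      simp_rw [e]
      refine sum_cos_add_int_mul_node hN0 (fun hd => ?_) _
      have := Int.eq_zero_of_dvd_of_natAbs_lt_natAbs hd (by simp only [Int.natAbs_neg, Int.natAbs_natCast]; omega)
      omega
    rw [hp, hq, add_zero, zero_div]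
  rw [h1, h2]
  ring

/-! ## §3 The first moment of the Jackson weights [folklore] -/

/-- Jordan's inequality in the form `v² ≤ (π²∕4)(2 − 2cos v)` for `|v| ≤ π` (re-derivation of the tree's private
`Literature.Analysis.Quadrature.Jackson.sq_le_pi_sq_mul`; Mathlib `Real.mul_le_sin`). [folklore] -/
theorem sq_le_pi_sq_mul_two_sub_two_cos (v : ℝ) (hv : |v| ≤ π) : v ^ 2 ≤ (π ^ 2 / 4) * (2 - 2 * Real.cos v) := by
  have h0 : 0 ≤ |v| / 2 := by positivity
  have h1 : |v| / 2 ≤ π / 2 := by linarith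
  have hj := Real.mul_le_sin h0 h1
  have hsq : Real.sin (|v| / 2) ^ 2 = Real.sin (v / 2) ^ 2 := by
    rcases abs_choice v with h | h
    · rw [h]
    · rw [h, neg_div, Real.sin_neg, neg_sq]
  have hs : Real.sin (v / 2) ^ 2 = (1 - Real.cos v) / 2 := by
    rw [Real.sin_sq_eq_half_sub]; ring_nf
  have hl : 0 ≤ 2 / π * (|v| / 2) := by positivity
  have h2 : (2 / π * (|v| / 2)) ^ 2 ≤ Real.sin (|v| / 2) ^ 2 := pow_le_pow_left₀ hl hj 2
  rw [hsq, hs] at h2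
  have h3 : (2 / π * (|v| / 2)) ^ 2 = v ^ 2 / π ^ 2 := by
    field_simp; rw [sq_abs]
  rw [h3, div_le_iff₀ (by positivity)] at h2
  nlinarith [h2]

/-- Reduction mod `2π`: every real `u` is `v + ℓ·2π` with `|v| ≤ π`, `ℓ ∈ ℤ` (`ℓ = round(u∕2π)`). [folklore] -/
theorem exists_abs_le_pi_add_int_mul_two_pi (u : ℝ) : ∃ v : ℝ, ∃ ℓ : ℤ, |v| ≤ π ∧ u = v + ℓ * (2 * π) := by
  refine ⟨u - round (u / (2 * π)) * (2 * π), round (u / (2 * π)), ?_, by ring⟩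
  have hπ : 0 < π := Real.pi_pos
  have h := abs_sub_round (u / (2 * π))
  have e : u - round (u / (2 * π)) * (2 * π) = (u / (2 * π) - round (u / (2 * π))) * (2 * π) := by
    field_simp
  rw [e, abs_mul, abs_of_pos (by positivity : (0 : ℝ) < 2 * π)]
  nlinarith

/-- The elementary trade `2|v| ≤ (m∕π)·v² + π∕m` (`m > 0`). [folklore] -/
theorem two_mul_abs_le_trade {m : ℝ} (hm : 0 < m) (v : ℝ) : 2 * |v| ≤ m / π * v ^ 2 + π / m := by
  have hπ : 0 < π := Real.pi_pos
  have hm' : m ≠ 0 := hm.ne'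
  have hπ' : π ≠ 0 := hπ.ne'
  have h : 0 ≤ m / π * (|v| - π / m) ^ 2 := by positivity
  have e : m / π * (|v| - π / m) ^ 2 = m / π * |v| ^ 2 + π / m - 2 * |v| := by
    field_simp
    ring
  rw [e, sq_abs] at h
  linarith

/-- **FIRST MOMENT OF THE JACKSON WEIGHTS**: `Σ_{a<N} F_m(t − 2πa∕N)²·|cos t − cos(2πa∕N)| ≤ π·N·c_m∕m` (`2m ≤ N`, `m ≥ 1`).  Termwise
`|cos t − cos θ_a| ≤ |v_a| ≤ ((m∕π)v_a² + π∕m)∕2 ≤ ((m∕π)(π²∕4)(2 − 2cos(t − θ_a)) + π∕m)∕2` with `v_a ≡ t − θ_a (mod 2π)`, `|v_a| ≤ π`; then §2 and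
`m³ ≤ 2c_m`. [folklore] -/
theorem sum_fejerSq_mul_abs_cos_sub_le {m N : ℕ} (hm : 0 < m) (hN : 2 * m ≤ N) (t : ℝ) :
    ∑ a ∈ range N, (∑ j₁ ∈ range m, ∑ j₂ ∈ range m, Real.cos (((j₁ : ℝ) - j₂) * (t - 2 * π * a / N))) ^ 2 *
        |Real.cos t - Real.cos (2 * π * a / N)| ≤ π * N * (m * (2 * m ^ 2 + 1) / 3) / m := by
  have hmr : (0 : ℝ) < m := Nat.cast_pos.2 hm
  have hπ : 0 < π := Real.pi_pos
  -- scalar bookkeeping: `((m∕π)(π²∕4)X + π∕m)∕2 = (mπ∕8)X + π∕(2m)`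
  have hscal : ∀ X : ℝ, (m / π * (π ^ 2 / 4 * X) + π / m) / 2 = m * π / 8 * X + π / (2 * m) := by
    intro X
    field_simp
    ring
  -- termwise bound
  have hterm : ∀ a : ℕ, |Real.cos t - Real.cos (2 * π * a / N)| ≤
      m * π / 8 * (2 - 2 * Real.cos (t - 2 * π * a / N)) + π / (2 * m) := by
    intro a
    rw [← hscal]
    obtain ⟨v, ℓ, hv, hu⟩ := exists_abs_le_pi_add_int_mul_two_pi (t - 2 * π * a / N)
    have hcos : Real.cos (2 * π * a / N) = Real.cos (t - v) := by
      have e : t - v = 2 * π * a / N + ℓ * (2 * π) := by linarith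
      rw [e, Real.cos_add_int_mul_two_pi]
    have hcv : Real.cos (t - 2 * π * a / N) = Real.cos v := by
      rw [hu, Real.cos_add_int_mul_two_pi]
    have h1 : |Real.cos t - Real.cos (2 * π * a / N)| ≤ |v| := by
      rw [hcos]
      refine (Real.abs_cos_sub_cos_le _ _).trans (le_of_eq ?_)
      rw [show t - (t - v) = v by ring]
    have h2 := two_mul_abs_le_trade hmr v
    have h3 := sq_le_pi_sq_mul_two_sub_two_cos v hv
    rw [hcv]
    have h4 : m / π * v ^ 2 ≤ m / π * (π ^ 2 / 4 * (2 - 2 * Real.cos v)) := mul_le_mul_of_nonneg_left h3 (by positivity)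
    linarith
  calc ∑ a ∈ range N, (∑ j₁ ∈ range m, ∑ j₂ ∈ range m, Real.cos (((j₁ : ℝ) - j₂) * (t - 2 * π * a / N))) ^ 2 *
          |Real.cos t - Real.cos (2 * π * a / N)|
      ≤ ∑ a ∈ range N, (∑ j₁ ∈ range m, ∑ j₂ ∈ range m, Real.cos (((j₁ : ℝ) - j₂) * (t - 2 * π * a / N))) ^ 2 *
          (m * π / 8 * (2 - 2 * Real.cos (t - 2 * π * a / N)) + π / (2 * m)) :=
        Finset.sum_le_sum fun a _ => mul_le_mul_of_nonneg_left (hterm a) (sq_nonneg _)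
    _ = m * π / 8 * ∑ a ∈ range N, (2 - 2 * Real.cos (t - 2 * π * a / N)) *
            (∑ j₁ ∈ range m, ∑ j₂ ∈ range m, Real.cos (((j₁ : ℝ) - j₂) * (t - 2 * π * a / N))) ^ 2 +
          π / (2 * m) * ∑ a ∈ range N,
            (∑ j₁ ∈ range m, ∑ j₂ ∈ range m, Real.cos (((j₁ : ℝ) - j₂) * (t - 2 * π * a / N))) ^ 2 := by
        rw [Finset.mul_sum, Finset.mul_sum, ← Finset.sum_add_distrib]
        refine Finset.sum_congr rfl fun a _ => ?_
        ring
    _ = m * π / 8 * (2 * N * m) + π / (2 * m) * (N * (m * (2 * m ^ 2 + 1) / 3)) := by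
        rw [sum_two_sub_two_cos_mul_fejerSq_node_eq hm hN, sum_fejerSq_node_eq hm hN]
    _ ≤ π * N * (m * (2 * m ^ 2 + 1) / 3) / m := by
        have hNr : (0 : ℝ) ≤ N := Nat.cast_nonneg _
        have hm' : (m : ℝ) ≠ 0 := hmr.ne'
        have hπ' : π ≠ 0 := hπ.ne'
        have e : π * N * (m * (2 * m ^ 2 + 1) / 3) / m - (m * π / 8 * (2 * N * m) + π / (2 * m) * (N * (m * (2 * m ^ 2 + 1) / 3))) =
            π * N / (4 * m) * (2 * (m * (2 * m ^ 2 + 1) / 3) - m ^ 3) := by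
          field_simp
          ring
        have hpos : 0 ≤ π * N / (4 * m) * (2 * (m * (2 * m ^ 2 + 1) / 3) - m ^ 3) := by
          have e2 : 2 * ((m : ℝ) * (2 * m ^ 2 + 1) / 3) - m ^ 3 = (m ^ 3 + 2 * m) / 3 := by ring
          rw [e2]
          positivity
        linarith

end Summit.QuantumFields.YangMills.Theorems.BalabanUVNodesN19DiscreteJackson

end
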